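import Summits.QuantumFields.YangMills.Theorems.BalabanUVNodesN07COfRecordRealSliceNhds
import Summits.QuantumFields.YangMills.Theorems.BalabanUVNodesN07QOfRecordTraceSectors
import HarnessLib

/-!
# NODE N07 — THE TRACE LETTERS OF def-Y's CONSTRAINT `C^{𝔰𝔩} = C ∘ P`: (i) `C^{𝔰𝔩}` is BLIND TO THE SCALAR DIRECTIONS (`C^{𝔰𝔩}(A′ + δ) = C^{𝔰𝔩}(A′)` whenever `Pδ = 0`),
# hence so are `DC^{𝔰𝔩}`, `D²C^{𝔰𝔩}` and the second-order part `C⁽²⁾ = quadPart C^{𝔰𝔩}`; (ii) near `0`, on Hermitian-presented jets, the values `C^{𝔰𝔩}(A′)(c)` are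
# TRACELESS (`tr log = 0` on `SU(N)` near `1`; `Q_k(U₀)` preserves traceless fields) — the trace companions of ✓`…N07COfRecordRealSliceNhds`
# ([15] (44) p. 285, (51) p. 286, (56) p. 286, (20) p. 281; [B9] (3.13) p. 393; [7] (21)–(23) p. 21)

Cell `pub-ymgap`, width seat `pub-ymgap-dag-n07-w3` (g27), CLAIM-2.  `--kind proof --supports stmt-QuantumFields-27238 --as helper`; count-neutral.
[15] = [Balaban1985Variational]; [B9] = [Balaban1985BackgroundPropagators]; [7] = [Balaban1985Averaging].

WHY.  The `W`-row of ✓`Node00.BgSchemeChartLie.lieTokAt_of_rows` at `TY := evHerm0` needs `W(A′)` TRACELESS-valued for Hermitian traceless `A′` (`N = 2`).  In lit's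
`W = W₁ + W₂ + W₃ + curV0full` ((85)–(96)) the maps `HD = Emap`, `HD₃ = E3`, `T = T47` are differentiated along SCALAR directions `δ` (the trace of a transposed current
`Mᵗ K` at a bond is `⟨K, M(δ_b·1)⟩`); this file shows the constraint letter they are built from does not see such directions at all, and that its values are
traceless where the `SU(N)` chart applies.
* §1 (generic calculus, any `𝕜`-normed spaces) `fderiv_apply_eq_of_eventually_line` (a map agreeing with `t ↦ f A + t•v` along the line `A + tδ` near `t = 0` has `Df(A)δ = v`),
  `fderiv_apply_eq_zero_of_blind_line`, `fderiv_add_eq_of_forall_add`, `fderiv_fderiv_apply_eq_zero_of_forall_add`, `fderiv_fderiv_apply_apply_eq_zero_of_forall_add`.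
* §2 (record) `slProjLit_eq_zero_of_scalar`, ★`CslOfRecord_add_of_slProjLit_eq_zero`, `fderiv_CslOfRecord_apply_eq_zero`, `fderiv_CslOfRecord_add`,
  `fderiv_fderiv_CslOfRecord_apply_eq_zero`, `fderiv_fderiv_CslOfRecord_apply_apply_eq_zero`, ★★`quadPart_CslOfRecord_add` (`C⁽²⁾(Y + δ) = C⁽²⁾(Y)`),
  ★`fderiv_quadPart_CslOfRecord_apply_eq_zero`.
* §3 ★★★`trace_CslOfRecord_eventually_nhds` — at a guarded background, for `A′` near `0` with Hermitian presented field, every `C^{𝔰𝔩}(A′)(c)` is traceless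
  (lit ✓`ExpMeanLog.trace_mlog_eq_zero` on the `SU(N)` product `Ū^k(exp(iη_kPA′)U₀)(c)·Ū^kU₀(c)⋆`, ✓`trace_qCplxOp_eq_zero` on the linear term); `_of_herm0` form.

HONEST LABELS.  Calculus∕`*`-algebra bookkeeping over the tree's own letters; no estimate (the neighbourhood of §3 is not quantified); guard displayed.  Count-neutral;
N07 NOT discharged; P0 ⟨26900⟩ OPEN; R4 is the conditional finite-𝕋⁴ rung only.  Nothing here is a claim about the Yang–Mills mass gap (`Summit.QuantumFields`):
finite torus, fixed `ε`; nothing continuum ∕ OS ∕ Clay.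
-/

set_option autoImplicit false

noncomputable section

open scoped Matrix Matrix.Norms.L2Operator InnerProductSpace ComplexConjugate Topology

namespace Summit.QuantumFields.YangMills.Theorems.N07CslOfRecordTraceSectors

open Filter
open Literature.MathematicalPhysics.QuantumFieldTheory.Balaban1983to89
open Literature.MathematicalPhysics.QuantumFieldTheory.Balaban1983to89.T4Continuum (T4Family)
open T4Continuum BlockAveraging
open NormedSpace (exp)
open MatrixLog (mlog)
open B15AveragingHolomorphic (iterMh)
open B11Eq115Space (NegSize NegSup levWeight JetSup)
open B11Eq111FrakG (nabla115)
open B11Eq80Current (quadPart)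
open B12Lemma4Models (slProj slProj_apply trace_slProj)
open T4AdjointCovarianceUnitary (lieSU mem_lieSU_iff specialUnitaryAd)
open Node00
open Summit.QuantumFields.YangMills.Theorems.N07ConstraintLetterTangent (I_smul_mem_lieSU coeField_expChart_adInv_eq_expOver)
open Summit.QuantumFields.YangMills.Theorems.N07COfRecordRealSlice (star_evLit_slProjLit mem_unitary_coe_mul_star_coe)
open Summit.QuantumFields.YangMills.Theorems.N07QOfRecordTraceSectors (trace_qCplxOp_eq_zero)

/-! ## §1  Generic calculus: maps blind to a direction -/

section Calculus

variable {𝕜 : Type*} [NontriviallyNormedField 𝕜] {E X : Type*} [NormedAddCommGroup E] [NormedSpace 𝕜 E] [NormedAddCommGroup X] [NormedSpace 𝕜 X]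

/-- **A map that is AFFINE ALONG A LINE near `t = 0`, `f(A + tδ) = f(A) + t·v`, and differentiable at `A`, has `Df(A)δ = v`** (uniqueness of the derivative of
`t ↦ f(A + tδ)` at `0`). [folklore] [cite: Balaban1985Variational, (63) p.287 (where line derivatives define the currents)] -/
theorem fderiv_apply_eq_of_eventually_line {f : E → X} {A δ : E} {v : X} (hf : DifferentiableAt 𝕜 f A)
    (h : ∀ᶠ t : 𝕜 in 𝓝 0, f (A + t • δ) = f A + t • v) : fderiv 𝕜 f A δ = v := by
  have hl : HasDerivAt (fun t : 𝕜 => A + t • δ) δ 0 := by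
    simpa using ((hasDerivAt_id (0 : 𝕜)).smul_const δ).const_add A
  have hF : HasFDerivAt f (fderiv 𝕜 f A) (A + (0 : 𝕜) • δ) := by
    rw [zero_smul, add_zero]; exact hf.hasFDerivAt
  have h1 : HasDerivAt (fun t : 𝕜 => f (A + t • δ)) (fderiv 𝕜 f A δ) 0 := hF.comp_hasDerivAt (0 : 𝕜) hl
  have h2 : HasDerivAt (fun t : 𝕜 => f A + t • v) v 0 := by
    simpa using ((hasDerivAt_id (0 : 𝕜)).smul_const v).const_add (f A)
  have h2' : HasDerivAt (fun t : 𝕜 => f (A + t • δ)) v 0 := h2.congr_of_eventuallyEq h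
  exact h1.unique h2'

/-- **A map CONSTANT ALONG A LINE, `f(A + tδ) = f(A)` for all `t`, has `Df(A)δ = 0`** — with NO differentiability hypothesis (`fderiv = 0` off the differentiability set).
[folklore] [cite: Balaban1985Variational, (63) p.287] -/
theorem fderiv_apply_eq_zero_of_blind_line {f : E → X} {A δ : E} (h : ∀ t : 𝕜, f (A + t • δ) = f A) : fderiv 𝕜 f A δ = 0 := by
  by_cases hf : DifferentiableAt 𝕜 f A
  · exact fderiv_apply_eq_of_eventually_line hf (Eventually.of_forall fun t => by rw [h t, smul_zero, add_zero])
  · rw [fderiv_zero_of_not_differentiableAt hf, zero_apply]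

/-- **Translation invariance passes to the derivative**: `f(x + δ) = f(x)` for all `x` gives `Df(x + δ) = Df(x)`. [folklore] [cite: Balaban1985Variational, (56) p.286] -/
theorem fderiv_add_eq_of_forall_add {f : E → X} {δ : E} (h : ∀ x, f (x + δ) = f x) (x : E) : fderiv 𝕜 f (x + δ) = fderiv 𝕜 f x := by
  have hfun : (fun y => f (y + δ)) = f := funext h
  rw [← fderiv_comp_add_right, hfun]

/-- **… and is inherited by it along the whole line**: `f(x + δ′) = f(x)` for every `δ′ ∈ 𝕜·δ` gives `D(Df)(A)δ = 0`. [folklore] [cite: Balaban1985Variational, (56) p.286] -/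
theorem fderiv_fderiv_apply_eq_zero_of_forall_add {f : E → X} {δ : E} (h : ∀ (t : 𝕜) (x : E), f (x + t • δ) = f x) (A : E) :
    fderiv 𝕜 (fderiv 𝕜 f) A δ = 0 :=
  fderiv_apply_eq_zero_of_blind_line fun t => fderiv_add_eq_of_forall_add (h t) A

/-- **The mixed second derivative against a blind direction vanishes too**: `D²f(A)(y, δ) = 0` (the map `x ↦ Df(x)δ` is identically `0`). [folklore] [cite: Balaban1985Variational, (56) p.286] -/
theorem fderiv_fderiv_apply_apply_eq_zero_of_forall_add {f : E → X} {δ : E} (h : ∀ (t : 𝕜) (x : E), f (x + t • δ) = f x) (A y : E) :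
    fderiv 𝕜 (fderiv 𝕜 f) A y δ = 0 := by
  have hzero : (fun x => fderiv 𝕜 f x δ) = fun _ => (0 : X) := funext fun x => fderiv_apply_eq_zero_of_blind_line fun t => h t x
  by_cases hd : DifferentiableAt 𝕜 (fderiv 𝕜 f) A
  · have hc : fderiv 𝕜 (fun x => fderiv 𝕜 f x δ) A y = fderiv 𝕜 (fderiv 𝕜 f) A y δ := by
      rw [fderiv_clm_apply hd (differentiableAt_const δ)]
      simp
    rw [← hc, hzero, fderiv_const_apply, zero_apply]
  · rw [fderiv_zero_of_not_differentiableAt hd, zero_apply, zero_apply]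

end Calculus

/-! ## §2  At the record: `C^{𝔰𝔩}`, `DC^{𝔰𝔩}`, `D²C^{𝔰𝔩}` and `C⁽²⁾` are blind to the scalar directions -/

section Record

variable (F : T4Family) (N : ℕ) [NeZero N] (K : ℕ) (k : ℕ) (Ω : ℕ → Set (Site (F.P K) 0)) (U₀ : GaugeField (F.P K) 0 (SU N))
  [Fact (0 < (F.L : ℝ))] [Fact (0 < (F.P K).eta k)] (levB : PBond (F.P K) k → ℕ)

/-- A jet whose presented field is SCALAR at every bond is killed by the traceless projection `P`. [cite: Balaban1985Variational, (51) p.286; Balaban1987RG1, (1.8) p.261] -/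
theorem slProjLit_eq_zero_of_scalar {δ : Space115Lit F N K k Ω U₀}
    (hδ : ∀ b, ∃ r : ℂ, JetSup.equiv _ _ (nabla115 ((F.P K).eta k) (unitsOfRecord F N U₀)) δ b = r • (1 : Matrix (Fin N) (Fin N) ℂ)) :
    slProjLit F N K k Ω U₀ δ = 0 := by
  apply (JetSup.equiv _ _ (nabla115 ((F.P K).eta k) (unitsOfRecord F N U₀))).injective
  funext b
  obtain ⟨r, hr⟩ := hδ b
  rw [equiv_slProjLit, hr, JetSup.equiv_zero, Pi.zero_apply, slProj_apply, Matrix.trace_smul, Matrix.trace_one, Fintype.card_fin, smul_eq_mul]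
  have hN : (N : ℂ) ≠ 0 := Nat.cast_ne_zero.2 (NeZero.ne N)
  rw [show ((N : ℂ))⁻¹ * (r * (N : ℂ)) = r by field_simp, sub_self]

/-- ★ **`C^{𝔰𝔩}` IS BLIND TO THE SCALAR DIRECTIONS**: `C^{𝔰𝔩}(A′ + δ) = C^{𝔰𝔩}(A′)` whenever `Pδ = 0` (`C^{𝔰𝔩} = C ∘ P`, `P` linear). [cite: Balaban1985Variational, (44) p.285, (51) p.286] -/
theorem CslOfRecord_add_of_slProjLit_eq_zero {δ : Space115Lit F N K k Ω U₀} (hδ : slProjLit F N K k Ω U₀ δ = 0) (A : Space115Lit F N K k Ω U₀) :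
    CslOfRecord F N K k Ω U₀ levB (A + δ) = CslOfRecord F N K k Ω U₀ levB A := by
  rw [CslOfRecord_apply, CslOfRecord_apply, map_add, hδ, add_zero]

/-- `C^{𝔰𝔩}(A′ + tδ) = C^{𝔰𝔩}(A′)` along the whole scalar line. [cite: Balaban1985Variational, (44) p.285, (51) p.286] -/
theorem CslOfRecord_add_smul_of_slProjLit_eq_zero {δ : Space115Lit F N K k Ω U₀} (hδ : slProjLit F N K k Ω U₀ δ = 0) (t : ℂ) (A : Space115Lit F N K k Ω U₀) :
    CslOfRecord F N K k Ω U₀ levB (A + t • δ) = CslOfRecord F N K k Ω U₀ levB A :=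
  CslOfRecord_add_of_slProjLit_eq_zero F N K k Ω U₀ levB (by rw [map_smul, hδ, smul_zero]) A

/-- ★ **`DC^{𝔰𝔩}(A′)δ = 0` FOR A SCALAR DIRECTION `δ`**, at every `A′` (no differentiability needed). [cite: Balaban1985Variational, (44) p.285, (63) p.287] -/
theorem fderiv_CslOfRecord_apply_eq_zero {δ : Space115Lit F N K k Ω U₀} (hδ : slProjLit F N K k Ω U₀ δ = 0) (A : Space115Lit F N K k Ω U₀) :
    fderiv ℂ (CslOfRecord F N K k Ω U₀ levB) A δ = 0 :=
  fderiv_apply_eq_zero_of_blind_line fun t => CslOfRecord_add_smul_of_slProjLit_eq_zero F N K k Ω U₀ levB hδ t A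

/-- `DC^{𝔰𝔩}(A′ + δ) = DC^{𝔰𝔩}(A′)` for a scalar direction `δ`. [cite: Balaban1985Variational, (44) p.285, (56) p.286] -/
theorem fderiv_CslOfRecord_add {δ : Space115Lit F N K k Ω U₀} (hδ : slProjLit F N K k Ω U₀ δ = 0) (A : Space115Lit F N K k Ω U₀) :
    fderiv ℂ (CslOfRecord F N K k Ω U₀ levB) (A + δ) = fderiv ℂ (CslOfRecord F N K k Ω U₀ levB) A :=
  fderiv_add_eq_of_forall_add (CslOfRecord_add_of_slProjLit_eq_zero F N K k Ω U₀ levB hδ) A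

/-- ★ **`D²C^{𝔰𝔩}(A′)(δ, ·) = 0` FOR A SCALAR DIRECTION `δ`.** [cite: Balaban1985Variational, (56) p.286] -/
theorem fderiv_fderiv_CslOfRecord_apply_eq_zero {δ : Space115Lit F N K k Ω U₀} (hδ : slProjLit F N K k Ω U₀ δ = 0) (A : Space115Lit F N K k Ω U₀) :
    fderiv ℂ (fderiv ℂ (CslOfRecord F N K k Ω U₀ levB)) A δ = 0 :=
  fderiv_fderiv_apply_eq_zero_of_forall_add (fun t x => CslOfRecord_add_smul_of_slProjLit_eq_zero F N K k Ω U₀ levB hδ t x) A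

/-- ★ **`D²C^{𝔰𝔩}(A′)(y, δ) = 0` FOR A SCALAR DIRECTION `δ`.** [cite: Balaban1985Variational, (56) p.286] -/
theorem fderiv_fderiv_CslOfRecord_apply_apply_eq_zero {δ : Space115Lit F N K k Ω U₀} (hδ : slProjLit F N K k Ω U₀ δ = 0) (A y : Space115Lit F N K k Ω U₀) :
    fderiv ℂ (fderiv ℂ (CslOfRecord F N K k Ω U₀ levB)) A y δ = 0 :=
  fderiv_fderiv_apply_apply_eq_zero_of_forall_add (fun t x => CslOfRecord_add_smul_of_slProjLit_eq_zero F N K k Ω U₀ levB hδ t x) A y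

/-- ★★ **THE SECOND-ORDER PART `C⁽²⁾ = quadPart C^{𝔰𝔩}` IS BLIND TO THE SCALAR DIRECTIONS**: `C⁽²⁾(Y + δ) = C⁽²⁾(Y)` for `Pδ = 0`
(`C⁽²⁾(Y) = ½D²C^{𝔰𝔩}(0)(Y, Y)` and both mixed terms and `D²C^{𝔰𝔩}(0)(δ, δ)` vanish). [cite: Balaban1985Variational, (56) p.286, (78) p.290] -/
theorem quadPart_CslOfRecord_add {δ : Space115Lit F N K k Ω U₀} (hδ : slProjLit F N K k Ω U₀ δ = 0) (Y : Space115Lit F N K k Ω U₀) :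
    quadPart (CslOfRecord F N K k Ω U₀ levB) (Y + δ) = quadPart (CslOfRecord F N K k Ω U₀ levB) Y := by
  have h1 : fderiv ℂ (fderiv ℂ (CslOfRecord F N K k Ω U₀ levB)) 0 δ = 0 := fderiv_fderiv_CslOfRecord_apply_eq_zero F N K k Ω U₀ levB hδ 0
  have h2 : fderiv ℂ (fderiv ℂ (CslOfRecord F N K k Ω U₀ levB)) 0 Y δ = 0 := fderiv_fderiv_CslOfRecord_apply_apply_eq_zero F N K k Ω U₀ levB hδ 0 Y
  have hL : fderiv ℂ (fderiv ℂ (CslOfRecord F N K k Ω U₀ levB)) 0 (Y + δ) = fderiv ℂ (fderiv ℂ (CslOfRecord F N K k Ω U₀ levB)) 0 Y := by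
    rw [map_add, h1, add_zero]
  rw [quadPart, quadPart, iteratedFDeriv_two_apply, iteratedFDeriv_two_apply, hL, map_add, h2, add_zero]

/-- ★ **`DC⁽²⁾(A′)δ = 0` FOR A SCALAR DIRECTION `δ`** (at every `A′`). [cite: Balaban1985Variational, (56) p.286, (78) p.290, (85) p.291] -/
theorem fderiv_quadPart_CslOfRecord_apply_eq_zero {δ : Space115Lit F N K k Ω U₀} (hδ : slProjLit F N K k Ω U₀ δ = 0) (A : Space115Lit F N K k Ω U₀) :
    fderiv ℂ (quadPart (CslOfRecord F N K k Ω U₀ levB)) A δ = 0 :=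
  fderiv_apply_eq_zero_of_blind_line fun t =>
    quadPart_CslOfRecord_add F N K k Ω U₀ levB (δ := t • δ) (by rw [map_smul, hδ, smul_zero]) A

end Record

/-! ## §3  At the record: the values of `C^{𝔰𝔩}` are traceless on Hermitian-presented jets near `0` -/

section Trace

variable (F : T4Family) (N : ℕ) [NeZero N] (K : ℕ) (k : ℕ) (Ω : ℕ → Set (Site (F.P K) 0)) (U₀ : GaugeField (F.P K) 0 (SU N))
  [Fact (0 < (F.L : ℝ))] [Fact (0 < (F.P K).eta k)] (levB : PBond (F.P K) k → ℕ)

/-- ★★★ **THE TRACE OF `C^{𝔰𝔩}` ON A NEIGHBOURHOOD**: at a guarded background, for every `A′` near `0` whose presented field is Hermitian, every value `C^{𝔰𝔩}(A′)(c)` is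
TRACELESS — `(1/i)·log` of the `SU(N)` product `Ū^k(exp(iη_kPA′)U₀)(c)·Ū^kU₀(c)⋆` near `1` (`tr log = log det = 0`, lit ✓`ExpMeanLog.trace_mlog_eq_zero`) minus the traceless
linear term `Q_k(U₀)(PA′)(c)` (✓`trace_qCplxOp_eq_zero`). [cite: Balaban1985Variational, (44) p.285, (20) p.281, (51) p.286; Balaban1985Averaging, (21)–(23) p.21; Balaban1985BackgroundPropagators, (3.13) p.393] -/
theorem trace_CslOfRecord_eventually_nhds (hU₀ : SmallBelow (avOfRecord F N K) k U₀) :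
    ∀ᶠ A in 𝓝 (0 : Space115Lit F N K k Ω U₀), (∀ b, star (evLit F N K k Ω U₀ A b) = evLit F N K k Ω U₀ A b) →
      ∀ c : PBond (F.P K) k, (NegSup.equiv _ _ (CslOfRecord F N K k Ω U₀ levB A) c).trace = 0 := by
  letI : CStarAlgebra (Matrix (Fin N) (Fin N) ℂ) := {}
  have hNpos : (0 : ℝ) < N := Nat.cast_pos.2 (Nat.pos_of_ne_zero (NeZero.ne N))
  have hthr : (0 : ℝ) < 1 / (4 * N) := by positivity
  -- the direction map into n07's chart coordinates, continuous with value `0` at `0`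
  set Wmap : Space115Lit F N K k Ω U₀ → PBond (F.P K) 0 → lieSU (Fin N) := fun A b =>
    specialUnitaryAd (U₀ b)⁻¹ (suProj N (Complex.I • (((((F.P K).eta k : ℝ) : ℂ)) • evLit F N K k Ω U₀ (slProjLit F N K k Ω U₀ A) b))) with hWdef
  have hev : Continuous fun A : Space115Lit F N K k Ω U₀ => evLit F N K k Ω U₀ (slProjLit F N K k Ω U₀ A) :=
    (evLit F N K k Ω U₀).continuous_of_finiteDimensional.comp (slProjLit F N K k Ω U₀).continuous
  have hWc : Continuous Wmap := by
    refine continuous_pi fun b => ?_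
    exact (specialUnitaryAd (U₀ b)⁻¹).continuous.comp ((suProj N).continuous.comp
      ((((continuous_apply b).comp hev).const_smul ((((F.P K).eta k : ℝ) : ℂ))).const_smul Complex.I))
  have hW0 : Wmap 0 = 0 := by
    funext b
    simp only [hWdef, map_zero, Pi.zero_apply, smul_zero]
  have hWt : Tendsto Wmap (𝓝 0) (𝓝 0) := by simpa only [hW0] using hWc.tendsto 0
  -- (e1) the guard near `X = 0`; (e2) the argument of `log` within `1/(4N)` of `1`
  have hev₁ : ∀ᶠ X : PBond (F.P K) 0 → lieSU (Fin N) in 𝓝 0, SmallBelow (avOfRecord F N K) k (expChart U₀ X) := eventually_smallBelow_expChart hU₀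
  have hev₂ : ∀ᶠ X : PBond (F.P K) 0 → lieSU (Fin N) in 𝓝 0, ∀ c : PBond (F.P K) k,
      ‖iterM k (coeField (expChart U₀ X)) c * star ((Averaging.iter (avOfRecord F N K) k U₀ c : SU N) : Matrix (Fin N) (Fin N) ℂ) - 1‖ < 1 / (4 * N) := by
    refine eventually_all.2 fun c => ?_
    have hcont : ContinuousAt (fun X : PBond (F.P K) 0 → lieSU (Fin N) => iterM k (coeField (expChart U₀ X)) c *
        star ((Averaging.iter (avOfRecord F N K) k U₀ c : SU N) : Matrix (Fin N) (Fin N) ℂ) - 1) 0 :=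
      ((((continuousAt_apply c _).comp (contDiffAt_iterM_expChart (P := F.P K) hU₀).continuousAt)).mul continuousAt_const).sub continuousAt_const
    have h0 : iterM k (coeField (expChart U₀ (0 : PBond (F.P K) 0 → lieSU (Fin N)))) c *
        star ((Averaging.iter (avOfRecord F N K) k U₀ c : SU N) : Matrix (Fin N) (Fin N) ℂ) - 1 = 0 := by
      have hV0 : iterM k (coeField (expChart U₀ (0 : PBond (F.P K) 0 → lieSU (Fin N)))) c =
          ((Averaging.iter (avOfRecord F N K) k U₀ c : SU N) : Matrix (Fin N) (Fin N) ℂ) := by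
        rw [expChart_zero, ← coeField_iter_eq_iterM k hU₀]; rfl
      rw [hV0, coe_mul_star_coe_SU, sub_self]
    have htn : Tendsto (fun X : PBond (F.P K) 0 → lieSU (Fin N) => ‖iterM k (coeField (expChart U₀ X)) c *
        star ((Averaging.iter (avOfRecord F N K) k U₀ c : SU N) : Matrix (Fin N) (Fin N) ℂ) - 1‖) (𝓝 0) (𝓝 0) := by
      have h := hcont.norm.tendsto
      rwa [h0, norm_zero] at h
    exact htn.eventually (Iio_mem_nhds hthr)
  filter_upwards [hWt.eventually hev₁, hWt.eventually hev₂] with A h₁ h₂ hA c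
  -- the Hermitian traceless direction `Y = η_k·P A′` and the chart identity
  set Y : PBond (F.P K) 0 → Matrix (Fin N) (Fin N) ℂ := ((((F.P K).eta k : ℝ) : ℂ)) • evLit F N K k Ω U₀ (slProjLit F N K k Ω U₀ A) with hYdef
  have hY : ∀ b, star (Y b) = Y b := fun b => by
    rw [hYdef, Pi.smul_apply, star_smul, Complex.star_def, Complex.conj_ofReal, star_evLit_slProjLit F N K k Ω U₀ hA]
  have htr : ∀ b, (Y b).trace = 0 := fun b => by
    rw [hYdef, Pi.smul_apply, Matrix.trace_smul, evLit_slProjLit, trace_slProj, smul_zero]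
  have hWA : Wmap A = (1 : ℝ) • fun b => specialUnitaryAd (U₀ b)⁻¹ ⟨Complex.I • Y b, I_smul_mem_lieSU (hY b) (htr b)⟩ := by
    rw [one_smul]
    funext b
    simp only [hWdef]
    congr 1
    exact Subtype.ext (coe_suProj_of_mem (I_smul_mem_lieSU (hY b) (htr b)))
  have hchart : expOver U₀ ((((F.P K).eta k : ℝ) : ℂ) • evLit F N K k Ω U₀ (slProjLit F N K k Ω U₀ A)) = coeField (expChart U₀ (Wmap A)) := by
    rw [hWA, coeField_expChart_adInv_eq_expOver U₀ hY htr 1, Complex.ofReal_one, one_smul]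
  set G : SU N := Averaging.iter (avOfRecord F N K) k (expChart U₀ (Wmap A)) c with hG
  set V : SU N := Averaging.iter (avOfRecord F N K) k U₀ c with hV
  have hG' : iterM k (coeField (expChart U₀ (Wmap A))) c = (G : Matrix (Fin N) (Fin N) ℂ) := by
    rw [← coeField_iter_eq_iterM k h₁]; rfl
  -- `tr log (G V⋆) = 0`: `G V⋆ ∈ SU(N)`, `‖G V⋆ − 1‖ < 1/(4N)`
  have hsu : (G : Matrix (Fin N) (Fin N) ℂ) * star (V : Matrix (Fin N) (Fin N) ℂ) ∈ Matrix.specialUnitaryGroup (Fin N) ℂ := by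
    have hm := (G * V⁻¹).2
    rwa [Submonoid.coe_mul, coe_inv_SU] at hm
  have hsmall : ‖(G : Matrix (Fin N) (Fin N) ℂ) * star (V : Matrix (Fin N) (Fin N) ℂ) - 1‖ < 1 / (4 * N) := by
    have h := h₂ c
    rwa [hG'] at h
  have h3 : ‖(G : Matrix (Fin N) (Fin N) ℂ) * star (V : Matrix (Fin N) (Fin N) ℂ) - 1‖ ≤ 1 / 3 := by
    have hle : 1 / (4 * (N : ℝ)) ≤ 1 / 3 := by
      rw [div_le_div_iff₀ (by positivity) (by norm_num)]
      have h1 : (1 : ℝ) ≤ N := Nat.one_le_cast.2 (Nat.pos_of_ne_zero (NeZero.ne N))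
      linarith
    exact hsmall.le.trans hle
  have hπ : (Fintype.card (Fin N) : ℝ) * ‖(G : Matrix (Fin N) (Fin N) ℂ) * star (V : Matrix (Fin N) (Fin N) ℂ) - 1‖ < Real.pi := by
    rw [Fintype.card_fin]
    have h1 : (N : ℝ) * ‖(G : Matrix (Fin N) (Fin N) ℂ) * star (V : Matrix (Fin N) (Fin N) ℂ) - 1‖ < (N : ℝ) * (1 / (4 * N)) :=
      mul_lt_mul_of_pos_left hsmall hNpos
    have h2 : (N : ℝ) * (1 / (4 * N)) = 1 / 4 := by field_simp
    have h3' : (3 : ℝ) < Real.pi := Real.pi_gt_three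
    linarith
  have hlog : (mlog ((G : Matrix (Fin N) (Fin N) ℂ) * star (V : Matrix (Fin N) (Fin N) ℂ))).trace = 0 := ExpMeanLog.trace_mlog_eq_zero hsu h3 hπ
  -- the linear term is traceless
  have hlin : (qCplxOp k U₀ (evLit F N K k Ω U₀ (slProjLit F N K k Ω U₀ A)) c).trace = 0 :=
    trace_qCplxOp_eq_zero hU₀ (fun b => by rw [evLit_slProjLit, trace_slProj]) c
  rw [CslOfRecord_apply, COfRecord_apply, hchart, iterMh_coeField_of_smallBelow F N k _ h₁, coeField_apply, ← hG, ← hV, Matrix.trace_sub, Matrix.trace_smul,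
    hlog, smul_zero, hlin, sub_self]

/-- ★★★ **THE SAME FOR HERMITIAN-PRESENTED JETS read through `JetSup.equiv`** (the form the fixed-point files use): near `0`, `A′ᴴ = A′` (bondwise) gives traceless
`C^{𝔰𝔩}(A′)(c)` for every `c`. [cite: Balaban1985Variational, (44) p.285, (51) p.286] -/
theorem trace_CslOfRecord_eventually_nhds' (hU₀ : SmallBelow (avOfRecord F N K) k U₀) :
    ∀ᶠ A in 𝓝 (0 : Space115Lit F N K k Ω U₀),
      ((JetSup.equiv _ _ (nabla115 ((F.P K).eta k) (unitsOfRecord F N U₀))).symm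
        (star (JetSup.equiv _ _ (nabla115 ((F.P K).eta k) (unitsOfRecord F N U₀)) A)) : Space115Lit F N K k Ω U₀) = A →
      ∀ c : PBond (F.P K) k, (NegSup.equiv _ _ (CslOfRecord F N K k Ω U₀ levB A) c).trace = 0 := by
  filter_upwards [trace_CslOfRecord_eventually_nhds F N K k Ω U₀ levB hU₀] with A hAev hA
  refine hAev fun b => ?_
  have h := congrArg (fun B : Space115Lit F N K k Ω U₀ => JetSup.equiv _ _ (nabla115 ((F.P K).eta k) (unitsOfRecord F N U₀)) B (bondToLit (F.P K) 0 b)) hA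
  simpa only [Equiv.apply_symm_apply, Pi.star_apply, evLit_apply] using h

end Trace

end Summit.QuantumFields.YangMills.Theorems.N07CslOfRecordTraceSectors

end
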